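import Literature.AnabelianGeometry.EtaleTheta.Discharge.Sec3Cor38Cor411ii
import Literature.AnabelianGeometry.EtaleTheta.Discharge.Sec3HQOfRationalSupport
import Literature.AnabelianGeometry.EtaleTheta.Discharge.Sec3Cor38CriterionCoordOfRlf
import Literature.AnabelianGeometry.EtaleTheta.Discharge.Sec3Remark363
import Literature.AnabelianGeometry.EtaleTheta.Discharge.Sec3Remark363OfRlf
import Literature.AnabelianGeometry.EtaleTheta.Discharge.Sec3RatFnMonoidOn
import Literature.AnabelianGeometry.EtaleTheta.Discharge.Sec3BLambdaInjectiveOfRlf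
import Literature.AlgebraicGeometry.Frobenioids.EquivalencePreStepsFSMFF2008Assembly

/-!
# [EtTh] Corollary 3.8 (ii) at the canonical vocabularies — the criterion C38-L05 and Remark 3.6.3 inputs
# REPLACED by print-level clauses on the Def. 3.3 / 3.6 data (rational support, Rmk. 3.3.1, Prop. 3.4 (ii))

Mochizuki, *The étale theta function and its Frobenioid-theoretic manifestations*, Publ. RIMS **45** (2009),
Cor. 3.8 (ii), PDF pp. 80–82, proof p.81 l.13 – p.82 l.5 [cite: MochizukiEtTh2009, Cor 3.8 p.81]; Def. 3.6 (i)/(ii)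
pp. 76–77 (`Φ ⊆ Φ^{ℝ-log} := Φ₀^ℝ|_D`, `Φ₀^ℤ = Φ₀`, `Φ₀^ℚ = Φ₀^pf`) [cite: MochizukiEtTh2009, Def 3.6 p.76];
Remark 3.3.1 p.73 (every `Φ₀(Y)_𝔭 ≅ ℤ_{≥0}`); Remark 3.6.3 p.79; Prop. 3.4 (ii) p.74.
abc-iut cell, layer L2, cone node `EtTh:Cor3.8(ii)` (kernel id `N_EtTh_Cor3_8_ii`), seat abc-iut-w6-d040 (gen 2);
PROOF-ONLY sequel (0 definitions) of this lineage's `Discharge/Sec3Cor38Cor411ii.lean` (p432040), whose node closer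
`Cor38Hyp.cor38_ii_canonical_of_thm34ii` takes, besides `h34 := FrdI.Thm34ii` ([FrdI] Thm. 3.4 (ii), F-0711 — PROVED,
`FrdI.Thm34ii_holds`, abc-iut-L1-t11) and the standing residual `hBmon_i : IsMonoidOn C_i.ratFnFunctor`, the two
INTERFACE-LEVEL binders per side

* `hR_i : C_i.Remark363` ([EtTh] Rmk. 3.6.3, F-0581) and
* `h5_i : C_i.BsFldPreStepLimitCriterion (the perfection)` (sub-DAG `plan/L2/SUBDAG-EtTh-Cor38.md` row C38-L05).

WHAT THIS FILE DOES (the wiring asked for in abc-iut-w5-d130's HANDOFF, follow-up (i)): both binders are consumed from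
their landed producers BY NAME, so that the node closer's inputs become PRINT-LEVEL CLAUSES on the Def. 3.3 (iii) /
Def. 3.6 (i) data `(Φ₀, B₀, F₀, B₀^Λ, F₀^Λ)` and on `Φ ⊆ Φ₀^ℝ|_D`:

* C38-L05 ⟸ abc-iut-w5-d130's `TemperedFrobenioid.bsFldPreStepLimitCriterion_of_ratSupport` (p433386; over
  abc-iut-w4-d084's `bsFldPreStepLimitCriterion_of_coord'`): inputs `hP34Λ` (Prop. 3.4 (ii) at monoid type `Λ`, the
  typed field `Prop34Cnst.mem_FΛ_of_divΛ_eq_of`), `hNZ` (Def. 3.6 (ii)(b): a non-zero effective divisor of constants),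
  `hZQ` (Rmk. 3.3.1: every prime of `Φ₀(Y_W)` is a `ℤ`- or `ℚ`-prime), `hsat` (Def. 3.6 (i)/(ii) for `Λ ∈ {ℤ, ℚ}`:
  `Φ(W)` has rational support in `Φ₀^ℝ(Y_W)`); at the CONSTRUCTED `Λ = ℤ / ℚ` data `ofRlfZ` / `ofRlfQ` its
  `bsFldPreStepLimitCriterion_ofRlfZ_of_ratSupport` / `…ofRlfQ…` (p434562: `dm.Prop34`, `hcyc`, `hZQ`, `hsat`);
* Rmk. 3.6.3 ⟸ abc-iut-w5-d135's `TemperedFrobenioid.remark363_of_isSharp` (`hP34Λ`, `hFinv` = "`F₀^Λ(Y)` is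
  inverse-closed", Prop. 3.4 (ii) third isomorphism `F₀(Y) ≅ L^×`) / `remark363_of_prop34Cnst`, and at the constructed
  data abc-iut-w4-d008's `remark363_ofRlfZ` / `remark363_ofRlfQ` (`dm.Prop34`, `hF₀inv`);
* `h34 := FrdI.Thm34ii_holds` throughout.

THEOREMS (all conclude abc-iut-L2-t3's `Cor38_ii` AS TYPED, vocabulary parameter := [FrdI] Def. 4.5 (iv) read on
`(E, Φ)`, for `h : Cor38Hyp C₁ C₂` at `treeMonoidVocab` / `treeCatVocab`):
* `Cor38Hyp.cor38_ii_canonical_of_ratSupport` — inputs `hBmon_i`, `hR_i`, (`hP34Λ_i`, `hNZ_i`, `hZQ_i`, `hsat_i`);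
* `Cor38Hyp.cor38_ii_canonical_of_ratSupport_of_hFinv` — inputs `hBmon_i`, (`hP34Λ_i`, `hFinv_i`, `hNZ_i`, `hZQ_i`,
  `hsat_i`): no interface-level binder left;
* `Cor38Hyp.cor38_ii_canonical_of_structural` — the same with `hBmon_i` ⟸ (`hBinj_i`, `hFSM_i`) (abc-iut-L2-t3's
  `isMonoidOn_ratFnFunctor`) and `hP34Λ_i` ⟸ the typed Prop. 3.4 (ii) structure `T.Prop34Cnst cnst`: EVERY input is
  a named print-level clause;
* `Cor38Hyp.cor38_ii_ofRlfZ_of_ratSupport`, `Cor38Hyp.cor38_ii_ofRlfQ_of_ratSupport` — both tempered Frobenioids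
  over the CONSTRUCTED Def. 3.6 (i) data of monoid type `ℤ` (resp. `ℚ`): inputs `hBmon_i`, `dm_i.Prop34`, `hF₀inv_i`,
  `hcyc_i`, `hZQ_i`, `hsat_i` — `B₀`/`Φ₀`-level print statements only;
* `Cor38Hyp.cor38_ii_ofRlfZ_of_structural`, `Cor38Hyp.cor38_ii_ofRlfQ_of_structural` — the same with `hBmon_i` ⟸
  (`hB₀inj_i`, `hFSM_i`) through abc-iut-L2-t3's `RealifiedDivisorMonoids.ofRlfZ_hBinj` / `ofRlfQ_hBinj`
  (`Sec3BLambdaInjectiveOfRlf`): every input a named `B₀`/`Φ₀`/`D`-level clause.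

Nothing of L1 / abc-iut-w4-d008 / w4-d084 / w5-d124 / w5-d130 / w5-d135 is re-derived; no statement of print is
strengthened: the clauses `hsat`, `hcyc`, `hFinv`/`hF₀inv`, `hNZ`, `hZQ` are print's standing situation for the
geometric data and are NOT derivable from the typed interfaces (kernel certificates cited in the producers' files).
HONEST FRAMING: refereed pre-IUT material ([EtTh] §3 over [FrdI] §§3–5); nothing here bears on [IUTchIII] Cor. 3.12;
no side taken; typed ≠ proved — here proved modulo the displayed named binders.
-/

noncomputable section

namespace Literature.AnabelianGeometry.EtaleTheta

open CategoryTheory Opposite Function Literature.AlgebraicGeometry.Frobenioids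

universe u₀ v₀ u v w u₁ v₁

namespace Cor38Hyp

/-! ## §1 Generic Def. 3.6 (i) data at the canonical vocabularies -/

section Canonical

variable {D₀ : Type u₀} [Category.{v₀} D₀] {D₀' : Type u₀} [Category.{v₀} D₀']
  {T : RealifiedDivisorMonoids (D₀ := D₀) treeMonoidVocab.{w}}
  {T' : RealifiedDivisorMonoids (D₀ := D₀') treeMonoidVocab.{w}}
  {D : Type u} [Category.{v} D] {D' : Type u} [Category.{v} D']
  {IsRational IsStrictlyRational : (Dᵒᵖ ⥤ CommMonCat.{w}) → Prop}
  {IsRational' IsStrictlyRational' : (D'ᵒᵖ ⥤ CommMonCat.{w}) → Prop}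
  {C₁ : TemperedFrobenioid T D (treeCatVocab D IsRational IsStrictlyRational)}
  {C₂ : TemperedFrobenioid T' D' (treeCatVocab D' IsRational' IsStrictlyRational')} (h : Cor38Hyp C₁ C₂)

/-- **[EtTh] Cor. 3.8 (ii) AS TYPED at the canonical vocabularies, the criterion C38-L05 consumed from
rational support** (abc-iut-w5-d130's `bsFldPreStepLimitCriterion_of_ratSupport`, p433386): inputs `hBmon_i`
("`𝔹_i` is a monoid on `D_i`"), [EtTh] Rmk. 3.6.3 `hR_i` (F-0581), and per side the print-level clauses `hP34Λ_i`
(Prop. 3.4 (ii) at monoid type `Λ`), `hNZ_i` (Def. 3.6 (ii)(b)), `hZQ_i` (Rmk. 3.3.1: primes of `Φ₀(Y_W)` of type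
`ℤ`/`ℚ`), `hsat_i` (Def. 3.6 (i)/(ii), `Λ ∈ {ℤ, ℚ}`: rational support of `Φ_i(W)` in `Φ₀^ℝ(Y_W)`); [FrdI] Thm. 3.4 (ii)
:= `FrdI.Thm34ii_holds`. [cite: MochizukiEtTh2009, Cor 3.8 p.81] -/
theorem cor38_ii_canonical_of_ratSupport
    (hBmon₁ : IsMonoidOn C₁.ratFnFunctor) (hBmon₂ : IsMonoidOn C₂.ratFnFunctor)
    (hR₁ : C₁.Remark363) (hR₂ : C₂.Remark363)
    (hP34Λ₁ : ∀ (Y : D₀ᵒᵖ) (b : T.BΛ.obj Y) (r : T.ΦR.obj Y),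
      T.divΛ Y b = Algebra.GrothendieckGroup.of r → b ∈ T.FΛ Y)
    (hNZ₁ : ∀ A : Dᵒᵖ, ∃ u : (T.BΛ.obj (C₁.baseOp A) : Type w) × Algebra.GrothendieckGroup (C₁.Φ.carrier A),
      u ∈ C₁.cnstFn A ∧ ∃ Z : C₁.Φ.carrier A, Z ≠ 1 ∧ u.2 = Algebra.GrothendieckGroup.of Z)
    (hZQ₁ : ∀ (W : D) (𝔭 : Primes (T.Φ₀.obj (C₁.baseOp (op W)))),
      IsZMonoprime ↥𝔭.submonoid ∨ IsQMonoprime ↥𝔭.submonoid)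
    (hsat₁ : ∀ (W : D), ∀ x ∈ C₁.Φ.carrier (op W), ∃ (N : ℕ+) (d : T.Φ₀.obj (C₁.baseOp (op W))),
      x ^ (N : ℕ) = T.toR (C₁.baseOp (op W)) d)
    (hP34Λ₂ : ∀ (Y : D₀'ᵒᵖ) (b : T'.BΛ.obj Y) (r : T'.ΦR.obj Y),
      T'.divΛ Y b = Algebra.GrothendieckGroup.of r → b ∈ T'.FΛ Y)
    (hNZ₂ : ∀ A : D'ᵒᵖ, ∃ u : (T'.BΛ.obj (C₂.baseOp A) : Type w) × Algebra.GrothendieckGroup (C₂.Φ.carrier A),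
      u ∈ C₂.cnstFn A ∧ ∃ Z : C₂.Φ.carrier A, Z ≠ 1 ∧ u.2 = Algebra.GrothendieckGroup.of Z)
    (hZQ₂ : ∀ (W : D') (𝔭 : Primes (T'.Φ₀.obj (C₂.baseOp (op W)))),
      IsZMonoprime ↥𝔭.submonoid ∨ IsQMonoprime ↥𝔭.submonoid)
    (hsat₂ : ∀ (W : D'), ∀ x ∈ C₂.Φ.carrier (op W), ∃ (N : ℕ+) (d : T'.Φ₀.obj (C₂.baseOp (op W))),
      x ^ (N : ℕ) = T'.toR (C₂.baseOp (op W)) d) :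
    Literature.AnabelianGeometry.EtaleTheta.Cor38_ii
      (fun E _ Φ => ∀ (A : E) (α : Aut (Over.forget A)),
        (∀ (B : Over A) (x : Φ.obj (op B.left)),
          Literature.AlgebraicGeometry.Frobenioids.pull Φ (α.hom.app B) x = x) → α = 1) h :=
  h.cor38_ii_canonical_of_thm34ii FrdI.Thm34ii_holds hBmon₁ hBmon₂ hR₁ hR₂
    (C₁.bsFldPreStepLimitCriterion_of_ratSupport (C₁.isFrobenioid_treeCatVocab_of_isMonoidOn hBmon₁)
      hP34Λ₁ hNZ₁ hZQ₁ hsat₁)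
    (C₂.bsFldPreStepLimitCriterion_of_ratSupport (C₂.isFrobenioid_treeCatVocab_of_isMonoidOn hBmon₂)
      hP34Λ₂ hNZ₂ hZQ₂ hsat₂)

/-- **[EtTh] Cor. 3.8 (ii) AS TYPED at the canonical vocabularies with NO interface-level binder**: Rmk. 3.6.3 is
consumed from abc-iut-w5-d135's `remark363_of_isSharp` (the divisor monoids `Φ_i(A)` are perf-factorial, hence
sharp) given `hP34Λ_i` and `hFinv_i` ("`F₀^Λ(Y)` is inverse-closed" — Prop. 3.4 (ii): `F₀(Y) ≅ L^×`), and C38-L05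
from rational support as in `cor38_ii_canonical_of_ratSupport`.  Inputs: `hBmon_i` and, per side, the print-level
clauses `hP34Λ_i`, `hFinv_i`, `hNZ_i`, `hZQ_i`, `hsat_i`. [cite: MochizukiEtTh2009, Cor 3.8 p.81] -/
theorem cor38_ii_canonical_of_ratSupport_of_hFinv
    (hBmon₁ : IsMonoidOn C₁.ratFnFunctor) (hBmon₂ : IsMonoidOn C₂.ratFnFunctor)
    (hP34Λ₁ : ∀ (Y : D₀ᵒᵖ) (b : T.BΛ.obj Y) (r : T.ΦR.obj Y),
      T.divΛ Y b = Algebra.GrothendieckGroup.of r → b ∈ T.FΛ Y)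
    (hFinv₁ : ∀ (Y : D₀ᵒᵖ) (b : T.BΛ.obj Y), b ∈ T.FΛ Y → ∃ b' ∈ T.FΛ Y, b' * b = 1)
    (hNZ₁ : ∀ A : Dᵒᵖ, ∃ u : (T.BΛ.obj (C₁.baseOp A) : Type w) × Algebra.GrothendieckGroup (C₁.Φ.carrier A),
      u ∈ C₁.cnstFn A ∧ ∃ Z : C₁.Φ.carrier A, Z ≠ 1 ∧ u.2 = Algebra.GrothendieckGroup.of Z)
    (hZQ₁ : ∀ (W : D) (𝔭 : Primes (T.Φ₀.obj (C₁.baseOp (op W)))),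
      IsZMonoprime ↥𝔭.submonoid ∨ IsQMonoprime ↥𝔭.submonoid)
    (hsat₁ : ∀ (W : D), ∀ x ∈ C₁.Φ.carrier (op W), ∃ (N : ℕ+) (d : T.Φ₀.obj (C₁.baseOp (op W))),
      x ^ (N : ℕ) = T.toR (C₁.baseOp (op W)) d)
    (hP34Λ₂ : ∀ (Y : D₀'ᵒᵖ) (b : T'.BΛ.obj Y) (r : T'.ΦR.obj Y),
      T'.divΛ Y b = Algebra.GrothendieckGroup.of r → b ∈ T'.FΛ Y)
    (hFinv₂ : ∀ (Y : D₀'ᵒᵖ) (b : T'.BΛ.obj Y), b ∈ T'.FΛ Y → ∃ b' ∈ T'.FΛ Y, b' * b = 1)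
    (hNZ₂ : ∀ A : D'ᵒᵖ, ∃ u : (T'.BΛ.obj (C₂.baseOp A) : Type w) × Algebra.GrothendieckGroup (C₂.Φ.carrier A),
      u ∈ C₂.cnstFn A ∧ ∃ Z : C₂.Φ.carrier A, Z ≠ 1 ∧ u.2 = Algebra.GrothendieckGroup.of Z)
    (hZQ₂ : ∀ (W : D') (𝔭 : Primes (T'.Φ₀.obj (C₂.baseOp (op W)))),
      IsZMonoprime ↥𝔭.submonoid ∨ IsQMonoprime ↥𝔭.submonoid)
    (hsat₂ : ∀ (W : D'), ∀ x ∈ C₂.Φ.carrier (op W), ∃ (N : ℕ+) (d : T'.Φ₀.obj (C₂.baseOp (op W))),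
      x ^ (N : ℕ) = T'.toR (C₂.baseOp (op W)) d) :
    Literature.AnabelianGeometry.EtaleTheta.Cor38_ii
      (fun E _ Φ => ∀ (A : E) (α : Aut (Over.forget A)),
        (∀ (B : Over A) (x : Φ.obj (op B.left)),
          Literature.AlgebraicGeometry.Frobenioids.pull Φ (α.hom.app B) x = x) → α = 1) h :=
  h.cor38_ii_canonical_of_ratSupport hBmon₁ hBmon₂
    (C₁.remark363_of_isSharp (fun A => (C₁.isPerfFactorial (op A)).isDivisorial.isSharp) hP34Λ₁ hFinv₁)
    (C₂.remark363_of_isSharp (fun A => (C₂.isPerfFactorial (op A)).isDivisorial.isSharp) hP34Λ₂ hFinv₂)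
    hP34Λ₁ hNZ₁ hZQ₁ hsat₁ hP34Λ₂ hNZ₂ hZQ₂ hsat₂

/-- **[EtTh] Cor. 3.8 (ii) AS TYPED at the canonical vocabularies from NAMED PRINT-LEVEL CLAUSES ONLY**: the
standing residual `hBmon_i` ("`𝔹_i = B₀^Λ|_{D_i} ×_{(Φ^{ℝ-log})^gp} Φ_i^gp` is a monoid on `D_i`", [FrdI] Thm. 5.2
preamble) is consumed from abc-iut-L2-t3's `isMonoidOn_ratFnFunctor` given `hBinj_i` (pull-backs of `B₀^Λ` injective,
[FrdI] Def. 1.1 (ii)) and `hFSM_i` (FSM-morphisms of `D_i` are isomorphisms), and Prop. 3.4 (ii) at monoid type `Λ`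
from the typed structure `RealifiedDivisorMonoids.Prop34Cnst` (abc-iut-L2-t3, field `mem_FΛ_of_divΛ_eq_of`).
Inputs per side: `hBinj_i`, `hFSM_i`, `hP_i : T_i.Prop34Cnst cnst_i`, `hFinv_i`, `hNZ_i`, `hZQ_i`, `hsat_i`.
[cite: MochizukiEtTh2009, Cor 3.8 p.81] -/
theorem cor38_ii_canonical_of_structural
    {Dcnst : Type u₁} [Category.{v₁} Dcnst] {cnst : D₀ ⥤ Dcnst}
    {Dcnst' : Type u₁} [Category.{v₁} Dcnst'] {cnst' : D₀' ⥤ Dcnst'}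
    (hBinj₁ : ∀ {Y Y' : D₀ᵒᵖ} (g : Y ⟶ Y'), Injective (T.BΛ.map g).hom)
    (hFSM₁ : ∀ {A B : D} (α : B ⟶ A), IsFSM α → IsIso α)
    (hP₁ : T.Prop34Cnst cnst)
    (hFinv₁ : ∀ (Y : D₀ᵒᵖ) (b : T.BΛ.obj Y), b ∈ T.FΛ Y → ∃ b' ∈ T.FΛ Y, b' * b = 1)
    (hNZ₁ : ∀ A : Dᵒᵖ, ∃ u : (T.BΛ.obj (C₁.baseOp A) : Type w) × Algebra.GrothendieckGroup (C₁.Φ.carrier A),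
      u ∈ C₁.cnstFn A ∧ ∃ Z : C₁.Φ.carrier A, Z ≠ 1 ∧ u.2 = Algebra.GrothendieckGroup.of Z)
    (hZQ₁ : ∀ (W : D) (𝔭 : Primes (T.Φ₀.obj (C₁.baseOp (op W)))),
      IsZMonoprime ↥𝔭.submonoid ∨ IsQMonoprime ↥𝔭.submonoid)
    (hsat₁ : ∀ (W : D), ∀ x ∈ C₁.Φ.carrier (op W), ∃ (N : ℕ+) (d : T.Φ₀.obj (C₁.baseOp (op W))),
      x ^ (N : ℕ) = T.toR (C₁.baseOp (op W)) d)
    (hBinj₂ : ∀ {Y Y' : D₀'ᵒᵖ} (g : Y ⟶ Y'), Injective (T'.BΛ.map g).hom)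
    (hFSM₂ : ∀ {A B : D'} (α : B ⟶ A), IsFSM α → IsIso α)
    (hP₂ : T'.Prop34Cnst cnst')
    (hFinv₂ : ∀ (Y : D₀'ᵒᵖ) (b : T'.BΛ.obj Y), b ∈ T'.FΛ Y → ∃ b' ∈ T'.FΛ Y, b' * b = 1)
    (hNZ₂ : ∀ A : D'ᵒᵖ, ∃ u : (T'.BΛ.obj (C₂.baseOp A) : Type w) × Algebra.GrothendieckGroup (C₂.Φ.carrier A),
      u ∈ C₂.cnstFn A ∧ ∃ Z : C₂.Φ.carrier A, Z ≠ 1 ∧ u.2 = Algebra.GrothendieckGroup.of Z)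
    (hZQ₂ : ∀ (W : D') (𝔭 : Primes (T'.Φ₀.obj (C₂.baseOp (op W)))),
      IsZMonoprime ↥𝔭.submonoid ∨ IsQMonoprime ↥𝔭.submonoid)
    (hsat₂ : ∀ (W : D'), ∀ x ∈ C₂.Φ.carrier (op W), ∃ (N : ℕ+) (d : T'.Φ₀.obj (C₂.baseOp (op W))),
      x ^ (N : ℕ) = T'.toR (C₂.baseOp (op W)) d) :
    Literature.AnabelianGeometry.EtaleTheta.Cor38_ii
      (fun E _ Φ => ∀ (A : E) (α : Aut (Over.forget A)),
        (∀ (B : Over A) (x : Φ.obj (op B.left)),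
          Literature.AlgebraicGeometry.Frobenioids.pull Φ (α.hom.app B) x = x) → α = 1) h :=
  h.cor38_ii_canonical_of_ratSupport_of_hFinv (C₁.isMonoidOn_ratFnFunctor hBinj₁ hFSM₁)
    (C₂.isMonoidOn_ratFnFunctor hBinj₂ hFSM₂) hP₁.mem_FΛ_of_divΛ_eq_of hFinv₁ hNZ₁ hZQ₁ hsat₁
    hP₂.mem_FΛ_of_divΛ_eq_of hFinv₂ hNZ₂ hZQ₂ hsat₂

end Canonical

/-! ## §2 Both tempered Frobenioids over the CONSTRUCTED Def. 3.6 (i) data of monoid type `ℤ` / `ℚ` -/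

section Constructed

variable {D₀ : Type u₀} [Category.{v₀} D₀] {dm₁ : DivisorMonoids.{u₀, v₀, w} D₀}
  {hpf₁ : ∀ Y : D₀ᵒᵖ, IsPerfFactorial (dm₁.Φ₀.obj Y)}
  {V₁ : FrdIMonoidStub.{w}} {V₀₁ : FrdICatStub.{u₀, v₀, w} D₀}
  {D₀' : Type u₀} [Category.{v₀} D₀'] {dm₂ : DivisorMonoids.{u₀, v₀, w} D₀'}
  {hpf₂ : ∀ Y : D₀'ᵒᵖ, IsPerfFactorial (dm₂.Φ₀.obj Y)}
  {V₂ : FrdIMonoidStub.{w}} {V₀₂ : FrdICatStub.{u₀, v₀, w} D₀'}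
  {D : Type u} [Category.{v} D] {D' : Type u} [Category.{v} D']
  {IsRational IsStrictlyRational : (Dᵒᵖ ⥤ CommMonCat.{w}) → Prop}
  {IsRational' IsStrictlyRational' : (D'ᵒᵖ ⥤ CommMonCat.{w}) → Prop}

/-- **[EtTh] Cor. 3.8 (ii) AS TYPED for two tempered Frobenioids over the constructed Def. 3.6 (i) data of monoid
type `ℤ`** (`RealifiedDivisorMonoids.ofRlfZ dm hpf`: `B₀^ℤ = B₀`, `F₀^ℤ = F₀`, `Φ₀^ℝ = Φ₀^rlf`), modulo `hBmon_i` and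
`B₀`/`Φ₀`-LEVEL PRINT STATEMENTS ONLY: the typed Prop. 3.4 structure `dm_i.Prop34`, `hF₀inv_i` ("`F₀(Y) ≅ L^×`" is a
group), `hcyc_i` (Def. 3.6 (ii)(b): the divisors of constants at `Y` are powers of one effective divisor), `hZQ_i`
(Rmk. 3.3.1) and `hsat_i` (rational support of `Φ_i(W)` in `Φ₀(Y_W)^rlf`) — Rmk. 3.6.3 by abc-iut-w4-d008's
`remark363_ofRlfZ`, C38-L05 by abc-iut-w5-d130's `bsFldPreStepLimitCriterion_ofRlfZ_of_ratSupport`, [FrdI]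
Thm. 3.4 (ii) := `FrdI.Thm34ii_holds`. [cite: MochizukiEtTh2009, Cor 3.8 p.81] -/
theorem cor38_ii_ofRlfZ_of_ratSupport
    {C₁ : TemperedFrobenioid (RealifiedDivisorMonoids.ofRlfZ dm₁ hpf₁) D
      (treeCatVocab D IsRational IsStrictlyRational)}
    {C₂ : TemperedFrobenioid (RealifiedDivisorMonoids.ofRlfZ dm₂ hpf₂) D'
      (treeCatVocab D' IsRational' IsStrictlyRational')}
    (h : Cor38Hyp C₁ C₂)
    (hBmon₁ : IsMonoidOn C₁.ratFnFunctor) (hBmon₂ : IsMonoidOn C₂.ratFnFunctor)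
    (h34₁ : dm₁.Prop34 V₁ V₀₁)
    (hF₀inv₁ : ∀ (Y : D₀ᵒᵖ) (b : dm₁.B₀.obj Y), b ∈ dm₁.F₀ Y → ∃ b' ∈ dm₁.F₀ Y, b' * b = 1)
    (hcyc₁ : ∀ Y : D₀ᵒᵖ, ∃ d : dm₁.Φ₀.obj Y, ∀ b ∈ dm₁.F₀ Y, ∃ n : ℤ,
      dm₁.div₀ Y b = Algebra.GrothendieckGroup.of d ^ n)
    (hZQ₁ : ∀ (W : D) (𝔭 : Primes (dm₁.Φ₀.obj (C₁.baseOp (op W)))),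
      IsZMonoprime ↥𝔭.submonoid ∨ IsQMonoprime ↥𝔭.submonoid)
    (hsat₁ : ∀ (W : D), ∀ x ∈ C₁.Φ.carrier (op W), ∃ (N : ℕ+) (d : dm₁.Φ₀.obj (C₁.baseOp (op W))),
      x ^ (N : ℕ) = (hpf₁ (C₁.baseOp (op W))).toRealification (Perfection.of _ d))
    (h34₂ : dm₂.Prop34 V₂ V₀₂)
    (hF₀inv₂ : ∀ (Y : D₀'ᵒᵖ) (b : dm₂.B₀.obj Y), b ∈ dm₂.F₀ Y → ∃ b' ∈ dm₂.F₀ Y, b' * b = 1)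
    (hcyc₂ : ∀ Y : D₀'ᵒᵖ, ∃ d : dm₂.Φ₀.obj Y, ∀ b ∈ dm₂.F₀ Y, ∃ n : ℤ,
      dm₂.div₀ Y b = Algebra.GrothendieckGroup.of d ^ n)
    (hZQ₂ : ∀ (W : D') (𝔭 : Primes (dm₂.Φ₀.obj (C₂.baseOp (op W)))),
      IsZMonoprime ↥𝔭.submonoid ∨ IsQMonoprime ↥𝔭.submonoid)
    (hsat₂ : ∀ (W : D'), ∀ x ∈ C₂.Φ.carrier (op W), ∃ (N : ℕ+) (d : dm₂.Φ₀.obj (C₂.baseOp (op W))),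
      x ^ (N : ℕ) = (hpf₂ (C₂.baseOp (op W))).toRealification (Perfection.of _ d)) :
    Literature.AnabelianGeometry.EtaleTheta.Cor38_ii
      (fun E _ Φ => ∀ (A : E) (α : Aut (Over.forget A)),
        (∀ (B : Over A) (x : Φ.obj (op B.left)),
          Literature.AlgebraicGeometry.Frobenioids.pull Φ (α.hom.app B) x = x) → α = 1) h :=
  h.cor38_ii_canonical_of_thm34ii FrdI.Thm34ii_holds hBmon₁ hBmon₂
    (C₁.remark363_ofRlfZ h34₁ hF₀inv₁) (C₂.remark363_ofRlfZ h34₂ hF₀inv₂)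
    (C₁.bsFldPreStepLimitCriterion_ofRlfZ_of_ratSupport
      (C₁.isFrobenioid_treeCatVocab_of_isMonoidOn hBmon₁) h34₁ hcyc₁ hZQ₁ hsat₁)
    (C₂.bsFldPreStepLimitCriterion_ofRlfZ_of_ratSupport
      (C₂.isFrobenioid_treeCatVocab_of_isMonoidOn hBmon₂) h34₂ hcyc₂ hZQ₂ hsat₂)

/-- **[EtTh] Cor. 3.8 (ii) AS TYPED over the constructed `Λ = ℤ` data from NAMED `B₀`/`Φ₀`/`D`-LEVEL CLAUSES ONLY**:
as `cor38_ii_ofRlfZ_of_ratSupport`, with the standing residual `hBmon_i` consumed from abc-iut-L2-t3's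
`isMonoidOn_ratFnFunctor` ∘ `RealifiedDivisorMonoids.ofRlfZ_hBinj` given `hB₀inj_i` (pull-backs of `B₀` injective:
"the function field of a connected covering embeds in that of a covering above it", Def. 3.3 (iii)) and `hFSM_i`
(FSM-morphisms of `D_i` are isomorphisms). [cite: MochizukiEtTh2009, Cor 3.8 p.81] -/
theorem cor38_ii_ofRlfZ_of_structural
    {C₁ : TemperedFrobenioid (RealifiedDivisorMonoids.ofRlfZ dm₁ hpf₁) D
      (treeCatVocab D IsRational IsStrictlyRational)}
    {C₂ : TemperedFrobenioid (RealifiedDivisorMonoids.ofRlfZ dm₂ hpf₂) D'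
      (treeCatVocab D' IsRational' IsStrictlyRational')}
    (h : Cor38Hyp C₁ C₂)
    (hB₀inj₁ : ∀ {Y Y' : D₀ᵒᵖ} (g : Y ⟶ Y'), Injective (dm₁.B₀.map g).hom)
    (hFSM₁ : ∀ {A B : D} (α : B ⟶ A), IsFSM α → IsIso α)
    (h34₁ : dm₁.Prop34 V₁ V₀₁)
    (hF₀inv₁ : ∀ (Y : D₀ᵒᵖ) (b : dm₁.B₀.obj Y), b ∈ dm₁.F₀ Y → ∃ b' ∈ dm₁.F₀ Y, b' * b = 1)
    (hcyc₁ : ∀ Y : D₀ᵒᵖ, ∃ d : dm₁.Φ₀.obj Y, ∀ b ∈ dm₁.F₀ Y, ∃ n : ℤ,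
      dm₁.div₀ Y b = Algebra.GrothendieckGroup.of d ^ n)
    (hZQ₁ : ∀ (W : D) (𝔭 : Primes (dm₁.Φ₀.obj (C₁.baseOp (op W)))),
      IsZMonoprime ↥𝔭.submonoid ∨ IsQMonoprime ↥𝔭.submonoid)
    (hsat₁ : ∀ (W : D), ∀ x ∈ C₁.Φ.carrier (op W), ∃ (N : ℕ+) (d : dm₁.Φ₀.obj (C₁.baseOp (op W))),
      x ^ (N : ℕ) = (hpf₁ (C₁.baseOp (op W))).toRealification (Perfection.of _ d))
    (hB₀inj₂ : ∀ {Y Y' : D₀'ᵒᵖ} (g : Y ⟶ Y'), Injective (dm₂.B₀.map g).hom)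
    (hFSM₂ : ∀ {A B : D'} (α : B ⟶ A), IsFSM α → IsIso α)
    (h34₂ : dm₂.Prop34 V₂ V₀₂)
    (hF₀inv₂ : ∀ (Y : D₀'ᵒᵖ) (b : dm₂.B₀.obj Y), b ∈ dm₂.F₀ Y → ∃ b' ∈ dm₂.F₀ Y, b' * b = 1)
    (hcyc₂ : ∀ Y : D₀'ᵒᵖ, ∃ d : dm₂.Φ₀.obj Y, ∀ b ∈ dm₂.F₀ Y, ∃ n : ℤ,
      dm₂.div₀ Y b = Algebra.GrothendieckGroup.of d ^ n)
    (hZQ₂ : ∀ (W : D') (𝔭 : Primes (dm₂.Φ₀.obj (C₂.baseOp (op W)))),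
      IsZMonoprime ↥𝔭.submonoid ∨ IsQMonoprime ↥𝔭.submonoid)
    (hsat₂ : ∀ (W : D'), ∀ x ∈ C₂.Φ.carrier (op W), ∃ (N : ℕ+) (d : dm₂.Φ₀.obj (C₂.baseOp (op W))),
      x ^ (N : ℕ) = (hpf₂ (C₂.baseOp (op W))).toRealification (Perfection.of _ d)) :
    Literature.AnabelianGeometry.EtaleTheta.Cor38_ii
      (fun E _ Φ => ∀ (A : E) (α : Aut (Over.forget A)),
        (∀ (B : Over A) (x : Φ.obj (op B.left)),
          Literature.AlgebraicGeometry.Frobenioids.pull Φ (α.hom.app B) x = x) → α = 1) h :=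
  h.cor38_ii_ofRlfZ_of_ratSupport
    (C₁.isMonoidOn_ratFnFunctor (RealifiedDivisorMonoids.ofRlfZ_hBinj dm₁ hpf₁ hB₀inj₁) hFSM₁)
    (C₂.isMonoidOn_ratFnFunctor (RealifiedDivisorMonoids.ofRlfZ_hBinj dm₂ hpf₂ hB₀inj₂) hFSM₂)
    h34₁ hF₀inv₁ hcyc₁ hZQ₁ hsat₁ h34₂ hF₀inv₂ hcyc₂ hZQ₂ hsat₂

/-- **[EtTh] Cor. 3.8 (ii) AS TYPED for two tempered Frobenioids over the constructed Def. 3.6 (i) data of monoid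
type `ℚ`** (`RealifiedDivisorMonoids.ofRlfQ dm hpf`: `B₀^ℚ = B₀^pf`, `F₀^ℚ = F₀^pf`), modulo `hBmon_i` and the same
`B₀`/`Φ₀`-level print statements `dm_i.Prop34`, `hF₀inv_i`, `hcyc_i`, `hZQ_i`, `hsat_i` (Rmk. 3.6.3 by
`remark363_ofRlfQ`, C38-L05 by `bsFldPreStepLimitCriterion_ofRlfQ_of_ratSupport`).
[cite: MochizukiEtTh2009, Cor 3.8 p.81] -/
theorem cor38_ii_ofRlfQ_of_ratSupport
    {C₁ : TemperedFrobenioid (RealifiedDivisorMonoids.ofRlfQ dm₁ hpf₁) D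
      (treeCatVocab D IsRational IsStrictlyRational)}
    {C₂ : TemperedFrobenioid (RealifiedDivisorMonoids.ofRlfQ dm₂ hpf₂) D'
      (treeCatVocab D' IsRational' IsStrictlyRational')}
    (h : Cor38Hyp C₁ C₂)
    (hBmon₁ : IsMonoidOn C₁.ratFnFunctor) (hBmon₂ : IsMonoidOn C₂.ratFnFunctor)
    (h34₁ : dm₁.Prop34 V₁ V₀₁)
    (hF₀inv₁ : ∀ (Y : D₀ᵒᵖ) (b : dm₁.B₀.obj Y), b ∈ dm₁.F₀ Y → ∃ b' ∈ dm₁.F₀ Y, b' * b = 1)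
    (hcyc₁ : ∀ Y : D₀ᵒᵖ, ∃ d : dm₁.Φ₀.obj Y, ∀ b ∈ dm₁.F₀ Y, ∃ n : ℤ,
      dm₁.div₀ Y b = Algebra.GrothendieckGroup.of d ^ n)
    (hZQ₁ : ∀ (W : D) (𝔭 : Primes (dm₁.Φ₀.obj (C₁.baseOp (op W)))),
      IsZMonoprime ↥𝔭.submonoid ∨ IsQMonoprime ↥𝔭.submonoid)
    (hsat₁ : ∀ (W : D), ∀ x ∈ C₁.Φ.carrier (op W), ∃ (N : ℕ+) (d : dm₁.Φ₀.obj (C₁.baseOp (op W))),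
      x ^ (N : ℕ) = (hpf₁ (C₁.baseOp (op W))).toRealification (Perfection.of _ d))
    (h34₂ : dm₂.Prop34 V₂ V₀₂)
    (hF₀inv₂ : ∀ (Y : D₀'ᵒᵖ) (b : dm₂.B₀.obj Y), b ∈ dm₂.F₀ Y → ∃ b' ∈ dm₂.F₀ Y, b' * b = 1)
    (hcyc₂ : ∀ Y : D₀'ᵒᵖ, ∃ d : dm₂.Φ₀.obj Y, ∀ b ∈ dm₂.F₀ Y, ∃ n : ℤ,
      dm₂.div₀ Y b = Algebra.GrothendieckGroup.of d ^ n)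
    (hZQ₂ : ∀ (W : D') (𝔭 : Primes (dm₂.Φ₀.obj (C₂.baseOp (op W)))),
      IsZMonoprime ↥𝔭.submonoid ∨ IsQMonoprime ↥𝔭.submonoid)
    (hsat₂ : ∀ (W : D'), ∀ x ∈ C₂.Φ.carrier (op W), ∃ (N : ℕ+) (d : dm₂.Φ₀.obj (C₂.baseOp (op W))),
      x ^ (N : ℕ) = (hpf₂ (C₂.baseOp (op W))).toRealification (Perfection.of _ d)) :
    Literature.AnabelianGeometry.EtaleTheta.Cor38_ii
      (fun E _ Φ => ∀ (A : E) (α : Aut (Over.forget A)),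
        (∀ (B : Over A) (x : Φ.obj (op B.left)),
          Literature.AlgebraicGeometry.Frobenioids.pull Φ (α.hom.app B) x = x) → α = 1) h :=
  h.cor38_ii_canonical_of_thm34ii FrdI.Thm34ii_holds hBmon₁ hBmon₂
    (C₁.remark363_ofRlfQ h34₁ hF₀inv₁) (C₂.remark363_ofRlfQ h34₂ hF₀inv₂)
    (C₁.bsFldPreStepLimitCriterion_ofRlfQ_of_ratSupport
      (C₁.isFrobenioid_treeCatVocab_of_isMonoidOn hBmon₁) h34₁ hcyc₁ hZQ₁ hsat₁)
    (C₂.bsFldPreStepLimitCriterion_ofRlfQ_of_ratSupport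
      (C₂.isFrobenioid_treeCatVocab_of_isMonoidOn hBmon₂) h34₂ hcyc₂ hZQ₂ hsat₂)

/-- **[EtTh] Cor. 3.8 (ii) AS TYPED over the constructed `Λ = ℚ` data from NAMED `B₀`/`Φ₀`/`D`-LEVEL CLAUSES ONLY**:
as `cor38_ii_ofRlfQ_of_ratSupport`, with the standing residual `hBmon_i` consumed from abc-iut-L2-t3's
`isMonoidOn_ratFnFunctor` ∘ `RealifiedDivisorMonoids.ofRlfQ_hBinj` given `hB₀inj_i` (`B₀^ℚ = B₀^pf`, so `hBinj`
⟸ `hB₀inj` by L1's `perfectionMap_injective`) and `hFSM_i` (FSM-morphisms of `D_i` are isomorphisms). [cite: MochizukiEtTh2009, Cor 3.8 p.81] -/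
theorem cor38_ii_ofRlfQ_of_structural
    {C₁ : TemperedFrobenioid (RealifiedDivisorMonoids.ofRlfQ dm₁ hpf₁) D
      (treeCatVocab D IsRational IsStrictlyRational)}
    {C₂ : TemperedFrobenioid (RealifiedDivisorMonoids.ofRlfQ dm₂ hpf₂) D'
      (treeCatVocab D' IsRational' IsStrictlyRational')}
    (h : Cor38Hyp C₁ C₂)
    (hB₀inj₁ : ∀ {Y Y' : D₀ᵒᵖ} (g : Y ⟶ Y'), Injective (dm₁.B₀.map g).hom)
    (hFSM₁ : ∀ {A B : D} (α : B ⟶ A), IsFSM α → IsIso α)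
    (h34₁ : dm₁.Prop34 V₁ V₀₁)
    (hF₀inv₁ : ∀ (Y : D₀ᵒᵖ) (b : dm₁.B₀.obj Y), b ∈ dm₁.F₀ Y → ∃ b' ∈ dm₁.F₀ Y, b' * b = 1)
    (hcyc₁ : ∀ Y : D₀ᵒᵖ, ∃ d : dm₁.Φ₀.obj Y, ∀ b ∈ dm₁.F₀ Y, ∃ n : ℤ,
      dm₁.div₀ Y b = Algebra.GrothendieckGroup.of d ^ n)
    (hZQ₁ : ∀ (W : D) (𝔭 : Primes (dm₁.Φ₀.obj (C₁.baseOp (op W)))),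
      IsZMonoprime ↥𝔭.submonoid ∨ IsQMonoprime ↥𝔭.submonoid)
    (hsat₁ : ∀ (W : D), ∀ x ∈ C₁.Φ.carrier (op W), ∃ (N : ℕ+) (d : dm₁.Φ₀.obj (C₁.baseOp (op W))),
      x ^ (N : ℕ) = (hpf₁ (C₁.baseOp (op W))).toRealification (Perfection.of _ d))
    (hB₀inj₂ : ∀ {Y Y' : D₀'ᵒᵖ} (g : Y ⟶ Y'), Injective (dm₂.B₀.map g).hom)
    (hFSM₂ : ∀ {A B : D'} (α : B ⟶ A), IsFSM α → IsIso α)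
    (h34₂ : dm₂.Prop34 V₂ V₀₂)
    (hF₀inv₂ : ∀ (Y : D₀'ᵒᵖ) (b : dm₂.B₀.obj Y), b ∈ dm₂.F₀ Y → ∃ b' ∈ dm₂.F₀ Y, b' * b = 1)
    (hcyc₂ : ∀ Y : D₀'ᵒᵖ, ∃ d : dm₂.Φ₀.obj Y, ∀ b ∈ dm₂.F₀ Y, ∃ n : ℤ,
      dm₂.div₀ Y b = Algebra.GrothendieckGroup.of d ^ n)
    (hZQ₂ : ∀ (W : D') (𝔭 : Primes (dm₂.Φ₀.obj (C₂.baseOp (op W)))),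
      IsZMonoprime ↥𝔭.submonoid ∨ IsQMonoprime ↥𝔭.submonoid)
    (hsat₂ : ∀ (W : D'), ∀ x ∈ C₂.Φ.carrier (op W), ∃ (N : ℕ+) (d : dm₂.Φ₀.obj (C₂.baseOp (op W))),
      x ^ (N : ℕ) = (hpf₂ (C₂.baseOp (op W))).toRealification (Perfection.of _ d)) :
    Literature.AnabelianGeometry.EtaleTheta.Cor38_ii
      (fun E _ Φ => ∀ (A : E) (α : Aut (Over.forget A)),
        (∀ (B : Over A) (x : Φ.obj (op B.left)),
          Literature.AlgebraicGeometry.Frobenioids.pull Φ (α.hom.app B) x = x) → α = 1) h :=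
  h.cor38_ii_ofRlfQ_of_ratSupport
    (C₁.isMonoidOn_ratFnFunctor (RealifiedDivisorMonoids.ofRlfQ_hBinj dm₁ hpf₁ hB₀inj₁) hFSM₁)
    (C₂.isMonoidOn_ratFnFunctor (RealifiedDivisorMonoids.ofRlfQ_hBinj dm₂ hpf₂ hB₀inj₂) hFSM₂)
    h34₁ hF₀inv₁ hcyc₁ hZQ₁ hsat₁ h34₂ hF₀inv₂ hcyc₂ hZQ₂ hsat₂

end Constructed

end Cor38Hyp

end Literature.AnabelianGeometry.EtaleTheta

end
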